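import Summits.QuantumFields.BalabanUV.T4Continuum.Support.NE7SecondOrderChainRule
import HarnessLib

/-!
# NE7BorderedMultiplierTransport — THE MULTIPLIER TERM OF THE BORDERED HESSIAN CAN BE COMPUTED THROUGH ANY CONSTRAINT MAP WITH THE SAME REDUCED OBJECTIVE:
# if `M∘G = M∘Ψ` near `x` (two `C²` constraint maps `G, Ψ : E → S`, `G x = Ψ x`, a `C²` objective `M : S → ℝ`), then
# `DM[D²G(x)[u,u′]] + D²M[DG u, DG u′] = DM[D²Ψ(x)[u,u′]] + D²M[DΨ u, DΨ u′]`, and if moreover `DG(x)u = DΨ(x)u`, `DG(x)u′ = DΨ(x)u′` then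
# `DM[D²G(x)[u,u′]] = DM[D²Ψ(x)[u,u′]]` (lineage `b2b-balaban-t4-ne7-p1`, gen 119, file H1; memo ROAD-G119 §2 «(G′) via the stripped tower»)

Cell `pub-balaban`, rung (B)+1 sub-cell t4, CRUX PROVER NE7 #1 (OWNER of row NE7), generation 119.
WHY (memo ROAD-G119 §2).  In the bordered Hessian ✓ `NE7MinActHessianLagrangianAllData.minAct_hessian_lagrangian_allData`
(`D²m(0)[v,v] = min { w·D²𝒜(0)[X,X] − Dm(0)[D²𝒢(0)[X,X]] : Q′X = v }`) the constraint `𝒢 = levelQ∘chart_{U♯}` is the FRAMED `(j+1)`-fold average of [Balaban1985Averaging] (42), whose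
differential `dirIter = QbarIter + gaugeDir(framePotW)` (✓ `NE3TangentCovariantTower.dirIter_eq_QbarIter_add_gaugeDir`) carries the accumulated block frames — the obstruction of
ROAD-G118 §3(a) and of row NE7b's ✓ `NE7LevelMassesOfTower` («no representative-free bound can close the gap L^{2(j+1)}»).  By the fundamental equality (92)/(97) of
[Balaban1985Averaging] (✓ `B7Eq92Concrete.avgIter_mul_eq_gaugeAct`: the framed average is the GAUGE TRANSFORM, by the accumulated frame `v_{j+1}`, of the double-bar average) and the
invariance of the constrained minimal action under gauge transformations of the datum (✓ `NE7MultiplierAnnihilatesGaugeDirections.minAct_gaugeAct_corner`), the reduced objective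
`m∘𝒢` EQUALS `m∘Ψ` with `Ψ` the STRIPPED (double-bar) constraint map, whose differential is the straight tower `QbarIter` (mass-contracting, ✓ `NE3FramePotBoundWClass.l2sq_QbarIter_le_class`).
THIS FILE is the calculus step of that substitution: the multiplier term may be computed through `Ψ` instead of `𝒢`, exactly, up to two Hessian terms of `m` that CANCEL on top-frame-free
directions (`D𝒢 X = DΨ X`).  Pure second-order calculus over real normed spaces; the T⁴ instantiation is the successor file.
WHAT ([folklore]; 0 def, 0 sorry): `fderiv_fderiv_congr_of_eventuallyEq`; **`multiplier_transport`** (displayed identity); **`multiplier_transport_of_fderiv_eq`** (equal differentials on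
`u, u′` ⇒ equal multiplier terms); **`multiplier_transport_sub`** (the difference form `DM[D²G[u,u′]] = DM[D²Ψ[u,u′]] + D²M[DΨu,DΨu′] − D²M[DGu,DGu′]`); **`bordered_transport`** (the bordered
value `w·A − DM[D²G[u,u]]` rewritten through `Ψ`).
HONEST FRAMING (page 1): elementary calculus; nothing of Bałaban's asserted ([Balaban1985Averaging] (92)/(97) context only); NOT (G′), NOT NE7 as a spine node; spine 0∕9; finite T⁴ rung
(B)+1 — NOT infinite volume, NOT mass gap, NOT BetaPertH, NOT Clay.
-/

set_option autoImplicit false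

open scoped Topology
open Filter

namespace Summit.QuantumFields.BalabanUV.T4Continuum.NE7BorderedMultiplierTransport

open NE7SecondOrderChainRule (fderiv_fderiv_comp)

variable {E S : Type*} [NormedAddCommGroup E] [NormedSpace ℝ E] [NormedAddCommGroup S] [NormedSpace ℝ S]

/-- Second derivatives of functions that agree near a point agree at that point. [folklore] -/
theorem fderiv_fderiv_congr_of_eventuallyEq {F : Type*} [NormedAddCommGroup F] [NormedSpace ℝ F] {f g : E → F} {x : E}
    (h : f =ᶠ[𝓝 x] g) : fderiv ℝ (fderiv ℝ f) x = fderiv ℝ (fderiv ℝ g) x :=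
  (h.fderiv (𝕜 := ℝ)).fderiv_eq

/-- **MULTIPLIER TRANSPORT**: two `C²` constraint maps `G, Ψ : E → S` with `G x = Ψ x` and the same reduced objective `M∘G = M∘Ψ` near `x` (`M` `C²` at `G x`) have
`DM[D²G(x)[u,u′]] + D²M[DG(x)u, DG(x)u′] = DM[D²Ψ(x)[u,u′]] + D²M[DΨ(x)u, DΨ(x)u′]` (both sides are `D²(M∘G)(x)[u,u′] = D²(M∘Ψ)(x)[u,u′]`). [folklore] -/
theorem multiplier_transport {M : S → ℝ} {G Ψ : E → S} {x : E} (hGΨ : G x = Ψ x)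
    (hM : ContDiffAt ℝ 2 M (G x)) (hG : ContDiffAt ℝ 2 G x) (hΨ : ContDiffAt ℝ 2 Ψ x)
    (heq : (fun y => M (G y)) =ᶠ[𝓝 x] fun y => M (Ψ y)) (u u' : E) :
    fderiv ℝ M (G x) (fderiv ℝ (fderiv ℝ G) x u u') + fderiv ℝ (fderiv ℝ M) (G x) (fderiv ℝ G x u) (fderiv ℝ G x u')
      = fderiv ℝ M (G x) (fderiv ℝ (fderiv ℝ Ψ) x u u') + fderiv ℝ (fderiv ℝ M) (G x) (fderiv ℝ Ψ x u) (fderiv ℝ Ψ x u') := by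
  have hMΨ : ContDiffAt ℝ 2 M (Ψ x) := hGΨ ▸ hM
  have h1 := fderiv_fderiv_comp hM hG u u'
  have h2 := fderiv_fderiv_comp hMΨ hΨ u u'
  rw [← hGΨ] at h2
  have h3 : fderiv ℝ (fderiv ℝ (fun y => M (G y))) x u u' = fderiv ℝ (fderiv ℝ (fun y => M (Ψ y))) x u u' := by
    rw [fderiv_fderiv_congr_of_eventuallyEq heq]
  rw [h1, h2] at h3
  linarith

/-- **EQUAL DIFFERENTIALS ⇒ EQUAL MULTIPLIER TERMS**: in the setting of `multiplier_transport`, if `DG(x)u = DΨ(x)u` and `DG(x)u′ = DΨ(x)u′` then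
`DM[D²G(x)[u,u′]] = DM[D²Ψ(x)[u,u′]]` — the multiplier term of the bordered Hessian is blind to the difference of the two constraint maps. [folklore] -/
theorem multiplier_transport_of_fderiv_eq {M : S → ℝ} {G Ψ : E → S} {x : E} (hGΨ : G x = Ψ x)
    (hM : ContDiffAt ℝ 2 M (G x)) (hG : ContDiffAt ℝ 2 G x) (hΨ : ContDiffAt ℝ 2 Ψ x)
    (heq : (fun y => M (G y)) =ᶠ[𝓝 x] fun y => M (Ψ y)) {u u' : E}
    (hu : fderiv ℝ G x u = fderiv ℝ Ψ x u) (hu' : fderiv ℝ G x u' = fderiv ℝ Ψ x u') :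
    fderiv ℝ M (G x) (fderiv ℝ (fderiv ℝ G) x u u') = fderiv ℝ M (G x) (fderiv ℝ (fderiv ℝ Ψ) x u u') := by
  have h := multiplier_transport hGΨ hM hG hΨ heq u u'
  rw [hu, hu'] at h
  linarith

/-- **THE DIFFERENCE FORM**: `DM[D²G(x)[u,u′]] = DM[D²Ψ(x)[u,u′]] + D²M[DΨu, DΨu′] − D²M[DGu, DGu′]`. [folklore] -/
theorem multiplier_transport_sub {M : S → ℝ} {G Ψ : E → S} {x : E} (hGΨ : G x = Ψ x)
    (hM : ContDiffAt ℝ 2 M (G x)) (hG : ContDiffAt ℝ 2 G x) (hΨ : ContDiffAt ℝ 2 Ψ x)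
    (heq : (fun y => M (G y)) =ᶠ[𝓝 x] fun y => M (Ψ y)) (u u' : E) :
    fderiv ℝ M (G x) (fderiv ℝ (fderiv ℝ G) x u u')
      = fderiv ℝ M (G x) (fderiv ℝ (fderiv ℝ Ψ) x u u')
        + fderiv ℝ (fderiv ℝ M) (G x) (fderiv ℝ Ψ x u) (fderiv ℝ Ψ x u') - fderiv ℝ (fderiv ℝ M) (G x) (fderiv ℝ G x u) (fderiv ℝ G x u') := by
  have h := multiplier_transport hGΨ hM hG hΨ heq u u'
  linarith

/-- **THE BORDERED VALUE THROUGH THE SECOND CONSTRAINT MAP**: for any weight `w` and any number `A` (in the application `A = D²𝒜(0)[X,X]`, the fine Hessian),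
`w·A − DM[D²G(x)[u,u]] = w·A − DM[D²Ψ(x)[u,u]] − D²M[DΨu, DΨu] + D²M[DGu, DGu]`; on directions with `DG u = DΨ u` the last two terms cancel. [folklore] -/
theorem bordered_transport {M : S → ℝ} {G Ψ : E → S} {x : E} (hGΨ : G x = Ψ x)
    (hM : ContDiffAt ℝ 2 M (G x)) (hG : ContDiffAt ℝ 2 G x) (hΨ : ContDiffAt ℝ 2 Ψ x)
    (heq : (fun y => M (G y)) =ᶠ[𝓝 x] fun y => M (Ψ y)) (w A : ℝ) (u : E) :
    w * A - fderiv ℝ M (G x) (fderiv ℝ (fderiv ℝ G) x u u)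
      = w * A - fderiv ℝ M (G x) (fderiv ℝ (fderiv ℝ Ψ) x u u)
        - fderiv ℝ (fderiv ℝ M) (G x) (fderiv ℝ Ψ x u) (fderiv ℝ Ψ x u) + fderiv ℝ (fderiv ℝ M) (G x) (fderiv ℝ G x u) (fderiv ℝ G x u) := by
  have h := multiplier_transport hGΨ hM hG hΨ heq u u
  linarith

omit [NormedSpace ℝ E] [NormedAddCommGroup S] [NormedSpace ℝ S] in
/-- **TRANSPORT ALONG A COMMON REPARAMETRISATION OF THE VALUES**: the hypothesis `M∘G = M∘Ψ near x` of the preceding theorems holds whenever `G = τ ∘ Ψ` near `x` pointwise through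
maps `τ y : S → S` that leave `M` invariant (`M (τ y s) = M s` for all `s`; in the application `τ y` is the gauge transformation of the datum by the accumulated block frame of
[Balaban1985Averaging] (97) and `M` the constrained minimal action, invariant under gauge transformations of the datum). [folklore] -/
theorem eventuallyEq_of_invariant {M : S → ℝ} {G Ψ : E → S} {x : E} (τ : E → S → S) (hτ : ∀ y s, M (τ y s) = M s)
    (hfac : ∀ᶠ y in 𝓝 x, G y = τ y (Ψ y)) : (fun y => M (G y)) =ᶠ[𝓝 x] fun y => M (Ψ y) :=
  hfac.mono fun y hy => by
    show M (G y) = M (Ψ y)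
    rw [hy, hτ]

end Summit.QuantumFields.BalabanUV.T4Continuum.NE7BorderedMultiplierTransport
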